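import Mathlib

/-!
# Solo-blind kernel #268 — the `ℓ∞` diagonal-dominance (Varah) bound

UNIFORM OUTER LEMMA, part (i) (ENGINE-L-SPEC §15(o) "TO KERNELISE (i)"): for a square matrix `A`
whose rows are strictly diagonally dominant with margin `δ > 0`,
`δ + ∑_{j ≠ i} ‖A i j‖ ≤ ‖A i i‖` for every row `i`, one has

* `det_ne_zero` — `A` is invertible (Mathlib's Gershgorin/Lévy–Desplanques `det_ne_zero_of_sum_row_lt_diag`);
* `sup_le` — the a-priori `ℓ∞` estimate `‖y‖_∞ ≤ ‖A y‖_∞ / δ` (Varah 1975), stated entrywise: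
  if `‖(A *ᵥ y) i‖ ≤ X` for all `i` then `‖y i‖ ≤ X/δ` for all `i`;
* `sup_le_of_eq` — the same for a solution of `A *ᵥ y = x` with `‖x i‖ ≤ X`.

Applied on every finite truncation of the streak / roll chains `u_{m−1} + u_{m+1} = β_m u_m`
(`Re β_m ≥ 2 + √2 g² t`, off-diagonal row sums `≤ 2`, resp. `√2, 1+√2` in the first streak rows) this
gives `‖G̃‖_∞ ≤ 1/δ` with `δ = √2 g² T₀ − (√2 − 1)` uniformly in the truncation, phase and `κ`
(they only move `Im β`), which is the invertibility half of the outer lemma for `t ≥ T₀ = 11059`.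
-/

namespace Summit.AnomalousDissipation.SoloBlind.VarahBound

open Matrix Finset

variable {n : ℕ}

/-- **Invertibility** of a row-diagonally-dominant matrix with margin `δ > 0`. -/
theorem det_ne_zero (A : Matrix (Fin n) (Fin n) ℂ) {δ : ℝ} (hδ : 0 < δ)
    (hA : ∀ i, δ + ∑ j ∈ univ.erase i, ‖A i j‖ ≤ ‖A i i‖) : A.det ≠ 0 :=
  det_ne_zero_of_sum_row_lt_diag fun k => by linarith [hA k]

/-- **The dominant-row inequality**: at an index `i₀` where `‖y‖` is maximal,
`δ ‖y i₀‖ ≤ ‖(A y) i₀‖`. -/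
theorem key_row (A : Matrix (Fin n) (Fin n) ℂ) {δ : ℝ}
    (hA : ∀ i, δ + ∑ j ∈ univ.erase i, ‖A i j‖ ≤ ‖A i i‖) (y : Fin n → ℂ) {i₀ : Fin n}
    (hmax : ∀ j, ‖y j‖ ≤ ‖y i₀‖) : δ * ‖y i₀‖ ≤ ‖(A *ᵥ y) i₀‖ := by
  have hsplit : (A *ᵥ y) i₀ = A i₀ i₀ * y i₀ + ∑ j ∈ univ.erase i₀, A i₀ j * y j := by
    rw [mulVec, dotProduct, ← Finset.add_sum_erase _ _ (mem_univ i₀)]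
  have htail : ‖∑ j ∈ univ.erase i₀, A i₀ j * y j‖ ≤ (∑ j ∈ univ.erase i₀, ‖A i₀ j‖) * ‖y i₀‖ := by
    calc ‖∑ j ∈ univ.erase i₀, A i₀ j * y j‖ ≤ ∑ j ∈ univ.erase i₀, ‖A i₀ j * y j‖ := norm_sum_le _ _
      _ ≤ ∑ j ∈ univ.erase i₀, ‖A i₀ j‖ * ‖y i₀‖ :=
          sum_le_sum fun j _ => by rw [norm_mul]; gcongr; exact hmax j
      _ = (∑ j ∈ univ.erase i₀, ‖A i₀ j‖) * ‖y i₀‖ := by rw [sum_mul]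
  have h1 : ‖A i₀ i₀ * y i₀‖ ≤ ‖(A *ᵥ y) i₀‖ + ‖∑ j ∈ univ.erase i₀, A i₀ j * y j‖ := by
    have : A i₀ i₀ * y i₀ = (A *ᵥ y) i₀ - ∑ j ∈ univ.erase i₀, A i₀ j * y j := by
      rw [hsplit]; ring
    rw [this]; exact norm_sub_le _ _
  rw [norm_mul] at h1
  have h0 : 0 ≤ ‖y i₀‖ := norm_nonneg _
  have h2 : (δ + ∑ j ∈ univ.erase i₀, ‖A i₀ j‖) * ‖y i₀‖ ≤ ‖A i₀ i₀‖ * ‖y i₀‖ :=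
    mul_le_mul_of_nonneg_right (hA i₀) h0
  nlinarith [h1, htail, h2]

/-- **Varah's `ℓ∞` bound**: `‖(A y) i‖ ≤ X` for all `i` implies `‖y i‖ ≤ X/δ` for all `i`. -/
theorem sup_le (A : Matrix (Fin n) (Fin n) ℂ) {δ X : ℝ} (hδ : 0 < δ)
    (hA : ∀ i, δ + ∑ j ∈ univ.erase i, ‖A i j‖ ≤ ‖A i i‖) (y : Fin n → ℂ)
    (hX : ∀ i, ‖(A *ᵥ y) i‖ ≤ X) : ∀ i, ‖y i‖ ≤ X / δ := by
  intro i
  have hne : (univ : Finset (Fin n)).Nonempty := ⟨i, mem_univ i⟩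
  obtain ⟨i₀, -, hi₀⟩ := exists_max_image univ (fun j => ‖y j‖) hne
  have hmax : ∀ j, ‖y j‖ ≤ ‖y i₀‖ := fun j => hi₀ j (mem_univ j)
  have key := key_row A hA y hmax
  rw [le_div_iff₀ hδ]
  calc ‖y i‖ * δ ≤ ‖y i₀‖ * δ := by gcongr; exact hmax i
    _ ≤ X := by rw [mul_comm]; exact key.trans (hX i₀)

/-- **Varah's bound for a solution** of `A y = x`: `‖x i‖ ≤ X` for all `i` gives `‖y i‖ ≤ X/δ`. -/
theorem sup_le_of_eq (A : Matrix (Fin n) (Fin n) ℂ) {δ X : ℝ} (hδ : 0 < δ)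
    (hA : ∀ i, δ + ∑ j ∈ univ.erase i, ‖A i j‖ ≤ ‖A i i‖) {x y : Fin n → ℂ} (hxy : A *ᵥ y = x)
    (hX : ∀ i, ‖x i‖ ≤ X) : ∀ i, ‖y i‖ ≤ X / δ :=
  sup_le A hδ hA y fun i => by rw [hxy]; exact hX i

/-- **Margin from a diagonal lower bound**: if `‖A i i‖ ≥ D` and the off-diagonal row sums are
`≤ S` with `S < D`, the hypothesis of `sup_le` holds with `δ = D − S` (the form used for the chains:
`D = 2 + √2 g² T₀`, `S ∈ {√2, 1 + √2, 2}`). -/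
theorem margin_of_bounds (A : Matrix (Fin n) (Fin n) ℂ) {D S : ℝ}
    (hD : ∀ i, D ≤ ‖A i i‖) (hS : ∀ i, ∑ j ∈ univ.erase i, ‖A i j‖ ≤ S) :
    ∀ i, (D - S) + ∑ j ∈ univ.erase i, ‖A i j‖ ≤ ‖A i i‖ :=
  fun i => by linarith [hD i, hS i]

end Summit.AnomalousDissipation.SoloBlind.VarahBound
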